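import Mathlib
import Summits.ResolutionOfSingularities.ResolutionOfSingularities.Theorems.WeightedInvariantLocalWeightedDropCoeffTransportPoint
import Summits.ResolutionOfSingularities.ResolutionOfSingularities.Theorems.WeightedInvariantLocalWeightedDropApexFreeOrderDrop
import Summits.ResolutionOfSingularities.ResolutionOfSingularities.Theorems.WeightedInvariantLocalWeightedDropAxisNormalize
import Summits.ResolutionOfSingularities.ResolutionOfSingularities.Theorems.WeightedInvariantLocalWeightedDropNCOrderGrowth

/-!
# `WeightedInvariant.LocalWeightedDrop`, TOT₂ line (skeleton v32, residual `stub_spaceNCRankDrop`), piece S-NEAR part 1: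
# NEAR POINTS OF THE POINT BLOW-UP LIE ON THE PROJECTIVISED DIRECTRIX — (N1), hypersurface form, every characteristic, every dimension

Crux item stmt-ResolutionOfSingularities-8899 `LocalWeightedDrop` (route `ResolutionOfSingularities/WeightedInvariant`), engine skeleton v32
(res-L1-w43-lead-1, ddb48572591139d5), sub-line TOT2-LINE v1 (`L/res-L1-w43-lead-1/g4/TOT2-LINE.md` 178f8184c2767465) §4 (N1)/(E0).
[OURS · L1 W4.3, chain w43, res-L1-w43-stub-3 (gen 4) = S-NEAR hand (plan-1 DEALS gen 10 #9).  MODEL: Cossart–Jannsen–Saito, LNM 2270 (2020)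
Thm 2.14 (Hironaka–Mizutani «near points lie on ℙ(Dir_x(X))», [corpus:paper:cossart2020-desingularization-invariants-strategy p0038]) in the
generality the line needs — a HYPERSURFACE germ over a field, closed points of the exceptional divisor, the count game's sliced chart — where it is
ELEMENTARY and characteristic-free (no ridge / additive-polynomial analysis).  Nothing here is a statement of H. Hironaka's manuscript; the game is
the programme's own; AI-written, gate-accepted means sorry-free with standard axioms, not refereed.  Definition-free.]

SETTING.  `f ∈ k⟦x₀,…,x_n⟧`, `o : ℕ`, `F := in_o f` read as the function `v ↦ CobordantChart.initEval 1 v o f = Σ_{|e| = o} f_e v^e`; the point move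
(all weights `1`) at the exceptional point `c` with LIVE slot `i₀` (`c_{i₀} ≠ 0`): `f(s(c + y)) = s^o · G` and the count game's new position is read on
the SLICE `G|_{y_{i₀} = 0}` (`TupleGame.slice i₀ G` = the strict transform in the classical chart `x_{i₀} = c_{i₀} s`).  The new point is NEAR when the
sliced strict transform still has order `≥ o`.
* `taylorSum_of_degree_eq` — the Taylor coefficient `Σ_{|e|=o} f_e ∏_l C(e_l,β_l) c_l^{e_l−β_l}` at a degree-`o` exponent `β` is `f_β` (top part of
  `F(c + ·)` is `F`); `taylorSum_eq_coeff_slice` — at an exponent `β` with `β_{i₀} = 0` it is the coefficient of `s^o · y^β` of the SLICED total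
  transform (`CoeffTransport.coeff_cons_slice_subst_chart`).
* **`initEval_add_eq_of_taylor`** — if those Taylor coefficients vanish at every `β` with `β_{i₀} = 0`, `|β| < o`, then `F(v + c) = F(v)` for every
  `v` in the slice plane `v_{i₀} = 0` (evaluation of the polynomial `F(c + X)` by its coefficients, `CobordantChart.coeff_prod_C_add_X_pow`).
* **`initEval_add_smul_eq_of_slicePlane`** — HOMOGENEITY UPGRADE: invariance `F(v + c) = F(v)` on the slice plane (`c_{i₀} ≠ 0`) gives
  `F(X + t·c) = F(X)` for ALL `X`, `t` (write `X = μc + v`, `F(μc + v) = μ^o F(c + v/μ) = F(v)`).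
* **`initEval_add_smul_eq_of_near`** — (N1): at a NEAR point (`o ≤ ord G|_{y_{i₀}=0}`) of the point blow-up, `c` is a translation-invariance vector of
  the degree-`o` form: `∀ t v, in_o f (v + t·c) = in_o f (v)` — the binder shape of the engine's apex hypotheses (`hone`/`hcyl`); so the near points over
  `x` lie on `ℙ(Dir_x)` ⊂ `E_x`.
* **`order_slice_lt_of_apexTrivial`** — (E0): if the degree-`o` form has NO non-zero invariance vector (`e_x = 0`), every answer of the point move
  has sliced strict transform of order `< o` — the order drops at once at every point of the exceptional divisor.
Sequel (S-NEAR part 2): (N2) `e_{x′} ≤ e_x` at near points and (N3) curve centres; the `O`-decorated versions follow on S-SET's definitions.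
-/

set_option linter.dupNamespace false -- mandated namespace of this single-conjunct summit
set_option autoImplicit false

namespace Summit.ResolutionOfSingularities.ResolutionOfSingularities.Theorems

namespace TOT2Near

open MvPowerSeries Literature.AlgebraicGeometry.Resolution

variable {k : Type} [Field k] {n : ℕ}

/-! ## §1 The Taylor coefficients of the degree-`o` form at `c` -/

/-- Pointwise `β ≤ e` with equal degrees forces `β = e`. -/
theorem eq_of_forall_le_of_degree_eq {β e : Fin n →₀ ℕ} (hle : ∀ l, β l ≤ e l) (hdeg : β.degree = e.degree) : β = e := by
  rw [Finsupp.degree_eq_sum, Finsupp.degree_eq_sum] at hdeg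
  have heq := (Finset.sum_eq_sum_iff_of_le fun l _ => hle l).mp hdeg
  ext l
  exact heq l (Finset.mem_univ l)

/-- If a binomial product `∏_l C(e_l, β_l) · c_l^{e_l − β_l}` is non-zero then `β ≤ e` pointwise. -/
theorem le_of_prod_choose_ne_zero {c : Fin n → k} {e : Fin n →₀ ℕ} {β : Fin n →₀ ℕ}
    (h : ∏ l, (((e l).choose (β l) : k) * c l ^ (e l - β l)) ≠ 0) (l : Fin n) : β l ≤ e l := by
  by_contra hlt
  rw [not_le] at hlt
  exact h (Finset.prod_eq_zero (Finset.mem_univ l) (by rw [Nat.choose_eq_zero_of_lt hlt, Nat.cast_zero, zero_mul]))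

/-- **THE TOP TAYLOR COEFFICIENT IS THE COEFFICIENT**: at an exponent `β` of degree `o`,
`Σ_{|e| = o} f_e ∏_l C(e_l, β_l) c_l^{e_l − β_l} = f_β` (the degree-`o` part of `F(c + X)` is `F(X)`). -/
theorem taylorSum_of_degree_eq (f : MvPowerSeries (Fin n) k) (c : Fin n → k) {o : ℕ} {β : Fin n →₀ ℕ} (hβ : β.degree = o) :
    ∑ e ∈ (Finset.univ : Finset (Fin n)).finsuppAntidiag o, coeff e f * ∏ l, (((e l).choose (β l) : k) * c l ^ (e l - β l)) =
      coeff β f := by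
  classical
  have hβmem : β ∈ (Finset.univ : Finset (Fin n)).finsuppAntidiag o := by
    rw [ApexFreeOrderDrop.mem_antidiag_iff, ApexFreeOrderDrop.weight_one_eq_degree, hβ]
  rw [Finset.sum_eq_single β]
  · rw [Finset.prod_eq_one, mul_one]
    intro l _
    rw [Nat.choose_self, Nat.cast_one, Nat.sub_self, pow_zero, mul_one]
  · intro e he hne
    have hedeg : e.degree = o := by
      rw [ApexFreeOrderDrop.mem_antidiag_iff, ApexFreeOrderDrop.weight_one_eq_degree] at he
      exact he
    by_cases hprod : ∏ l, (((e l).choose (β l) : k) * c l ^ (e l - β l)) = 0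
    · rw [hprod, mul_zero]
    · exact absurd (eq_of_forall_le_of_degree_eq (le_of_prod_choose_ne_zero hprod) (hβ.trans hedeg.symm)).symm hne
  · intro h
    exact absurd hβmem h

/-- The exponent `β` with `β_{i₀} = 0` is the insertion at `i₀` of its restriction `τ` off `i₀`. -/
theorem mapDomain_succAbove_restrict {n : ℕ} (i₀ : Fin (n + 1)) (β : Fin (n + 1) →₀ ℕ) (hβ : β i₀ = 0) :
    Finsupp.mapDomain i₀.succAbove (Finsupp.equivFunOnFinite.symm fun j => β (i₀.succAbove j)) = β := by
  ext l
  by_cases hl : l = i₀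
  · subst hl
    rw [CoeffTransport.mapDomain_succAbove_apply_self, hβ]
  · exact CoeffTransport.mapDomain_succAbove_comap i₀ β l hl

/-- … and the restriction has the same degree. -/
theorem degree_restrict {n : ℕ} (i₀ : Fin (n + 1)) (β : Fin (n + 1) →₀ ℕ) (hβ : β i₀ = 0) :
    (Finsupp.equivFunOnFinite.symm fun j => β (i₀.succAbove j) : Fin n →₀ ℕ).degree = β.degree := by
  rw [Finsupp.degree_eq_sum, Finsupp.degree_eq_sum, Fin.sum_univ_succAbove _ i₀, hβ, zero_add]
  rfl

/-- **THE TAYLOR COEFFICIENTS OFF `x_{i₀}` ARE THE `s^o`-COEFFICIENTS OF THE SLICED TOTAL TRANSFORM**: for `β` with `β_{i₀} = 0` and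
restriction `τ`, `Σ_{|e| = o} f_e ∏_l C(e_l, β_l) c_l^{e_l − β_l} = coeff (cons o τ) ((f ∘ chart_c)|_{y_{i₀} = 0})`
(`CoeffTransport.coeff_cons_slice_subst_chart`). -/
theorem taylorSum_eq_coeff_slice {n : ℕ} (f : MvPowerSeries (Fin (n + 1)) k) (c : Fin (n + 1) → k) (i₀ : Fin (n + 1)) (o : ℕ)
    (β : Fin (n + 1) →₀ ℕ) (hβ : β i₀ = 0) :
    ∑ e ∈ (Finset.univ : Finset (Fin (n + 1))).finsuppAntidiag o, coeff e f * ∏ l, (((e l).choose (β l) : k) * c l ^ (e l - β l)) =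
      coeff (Finsupp.cons o (Finsupp.equivFunOnFinite.symm fun j => β (i₀.succAbove j)))
        (TupleGame.slice i₀ (subst (CobordantChart.chart (fun _ : Fin (n + 1) => 1) c) f)) := by
  rw [CoeffTransport.coeff_cons_slice_subst_chart, mapDomain_succAbove_restrict i₀ β hβ]
  rw [← ApexFreeOrderDrop.finsum_ite_weight_eq]
  refine finsum_congr fun d => ?_
  rw [ApexFreeOrderDrop.weight_one_eq_degree]

/-! ## §2 Vanishing Taylor coefficients off `x_{i₀}` ⇒ invariance of the form on the slice plane -/

/-- **`F(v + c) = F(v)` ON THE SLICE PLANE** from the vanishing of the Taylor coefficients `Σ_{|e|=o} f_e ∏ C(e_l,β_l) c_l^{e_l−β_l}` at every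
`β` with `β_{i₀} = 0` and `|β| < o` — evaluation of the polynomial `F(c + X) = Σ_{|e|=o} f_e ∏ (c_l + X_l)^{e_l}` through its coefficients
(`CobordantChart.coeff_prod_C_add_X_pow`): on `v_{i₀} = 0` only exponents with `β_{i₀} = 0` survive, below degree `o` they vanish by hypothesis,
in degree `o` they are `f_β` (`taylorSum_of_degree_eq`). -/
theorem initEval_add_eq_of_taylor (f : MvPowerSeries (Fin n) k) (c : Fin n → k) (i₀ : Fin n) {o : ℕ}
    (hT : ∀ β : Fin n →₀ ℕ, β i₀ = 0 → β.degree < o →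
      ∑ e ∈ (Finset.univ : Finset (Fin n)).finsuppAntidiag o, coeff e f * ∏ l, (((e l).choose (β l) : k) * c l ^ (e l - β l)) = 0)
    (v : Fin n → k) (hv : v i₀ = 0) :
    CobordantChart.initEval (fun _ : Fin n => 1) (v + c) o f = CobordantChart.initEval (fun _ : Fin n => 1) v o f := by
  classical
  set A := (Finset.univ : Finset (Fin n)).finsuppAntidiag o with hA
  set Pc : MvPolynomial (Fin n) k :=
    ∑ e ∈ A, MvPolynomial.C (coeff e f) * ∏ l, (MvPolynomial.C (c l) + MvPolynomial.X l) ^ (e l) with hPc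
  -- (a) `Pc` evaluates to `F(v + c)`
  have ha : MvPolynomial.eval v Pc = CobordantChart.initEval (fun _ : Fin n => 1) (v + c) o f := by
    rw [ApexFreeOrderDrop.initEval_one_eq_sum, hPc, map_sum]
    refine Finset.sum_congr rfl fun e _ => ?_
    rw [map_mul, MvPolynomial.eval_C, map_prod]
    congr 1
    refine Finset.prod_congr rfl fun l _ => ?_
    rw [map_pow, map_add, MvPolynomial.eval_C, MvPolynomial.eval_X, Pi.add_apply, add_comm]
  -- (b) the coefficients of `Pc` are the Taylor sums
  have hb : ∀ β : Fin n →₀ ℕ, MvPolynomial.coeff β Pc =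
      ∑ e ∈ A, coeff e f * ∏ l, (((e l).choose (β l) : k) * c l ^ (e l - β l)) := by
    intro β
    rw [hPc, MvPolynomial.coeff_sum]
    refine Finset.sum_congr rfl fun e _ => ?_
    rw [MvPolynomial.coeff_C_mul, CobordantChart.coeff_prod_C_add_X_pow c (⇑e) β]
  -- (c) a non-zero coefficient of `Pc` has degree `≤ o`
  have hdeg : ∀ β : Fin n →₀ ℕ, MvPolynomial.coeff β Pc ≠ 0 → β.degree ≤ o := by
    intro β hβ
    rw [hb] at hβ
    obtain ⟨e, he, hne⟩ := Finset.exists_ne_zero_of_sum_ne_zero hβ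
    have hedeg : e.degree = o := by
      rw [hA, ApexFreeOrderDrop.mem_antidiag_iff, ApexFreeOrderDrop.weight_one_eq_degree] at he
      exact he
    have hle := le_of_prod_choose_ne_zero (right_ne_zero_of_mul hne)
    rw [← hedeg, Finsupp.degree_eq_sum, Finsupp.degree_eq_sum]
    exact Finset.sum_le_sum fun l _ => hle l
  -- (d) evaluate `Pc` at `v` through its coefficients: only the degree-`o` exponents survive
  rw [← ha, MvPolynomial.eval_eq']
  have hsplit : ∑ β ∈ Pc.support, MvPolynomial.coeff β Pc * ∏ l, v l ^ β l =
      ∑ β ∈ A, MvPolynomial.coeff β Pc * ∏ l, v l ^ β l := by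
    -- terms of degree `< o` vanish: `β_{i₀} = 0` is killed by `hT`, `β_{i₀} > 0` by `v_{i₀} = 0`
    have hzero : ∀ β ∈ Pc.support, β ∉ A → MvPolynomial.coeff β Pc * ∏ l, v l ^ β l = 0 := by
      intro β hβ hβA
      have hne := MvPolynomial.mem_support_iff.mp hβ
      have hlt : β.degree < o := by
        refine lt_of_le_of_ne (hdeg β hne) fun h => hβA ?_
        rw [hA, ApexFreeOrderDrop.mem_antidiag_iff, ApexFreeOrderDrop.weight_one_eq_degree, h]
      by_cases hβ0 : β i₀ = 0
      · exact absurd ((hb β).trans (hT β hβ0 hlt)) hne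
      · rw [Finset.prod_eq_zero (Finset.mem_univ i₀) (by rw [hv, zero_pow hβ0]), mul_zero]
    rw [← Finset.sum_filter_add_sum_filter_not Pc.support (fun β => β ∈ A)]
    rw [Finset.sum_eq_zero (s := Pc.support.filter fun β => ¬ β ∈ A) (fun β hβ => by
      rw [Finset.mem_filter] at hβ
      exact hzero β hβ.1 hβ.2), add_zero]
    refine Finset.sum_subset (fun β hβ => (Finset.mem_filter.mp hβ).2) ?_
    intro β hβA hβnot
    have h0 : MvPolynomial.coeff β Pc = 0 := by
      by_contra h
      exact hβnot (Finset.mem_filter.mpr ⟨MvPolynomial.mem_support_iff.mpr h, hβA⟩)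
    rw [h0, zero_mul]
  rw [hsplit, ApexFreeOrderDrop.initEval_one_eq_sum]
  refine Finset.sum_congr rfl fun β hβ => ?_
  have hβdeg : β.degree = o := by
    have hβ' : β ∈ (Finset.univ : Finset (Fin n)).finsuppAntidiag o := hβ
    rw [ApexFreeOrderDrop.mem_antidiag_iff, ApexFreeOrderDrop.weight_one_eq_degree] at hβ'
    exact hβ'
  rw [hb, taylorSum_of_degree_eq f c hβdeg]

/-! ## §3 Homogeneity: invariance on the slice plane ⇒ invariance along the whole line `k · c` -/

/-- **HOMOGENEITY UPGRADE**: if `F(v + c) = F(v)` for every `v` with `v_{i₀} = 0` and `c_{i₀} ≠ 0`, then `F(X + t·c) = F(X)` for ALL `X`, `t`. -/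
theorem initEval_add_smul_eq_of_slicePlane {o : ℕ} {f : MvPowerSeries (Fin n) k} {c : Fin n → k} (i₀ : Fin n) (hc : c i₀ ≠ 0)
    (h : ∀ v : Fin n → k, v i₀ = 0 →
      CobordantChart.initEval (fun _ : Fin n => 1) (v + c) o f = CobordantChart.initEval (fun _ : Fin n => 1) v o f)
    (t : k) (X : Fin n → k) :
    CobordantChart.initEval (fun _ : Fin n => 1) (X + t • c) o f = CobordantChart.initEval (fun _ : Fin n => 1) X o f := by
  -- the slice-plane component of `X`
  set μ : k := X i₀ / c i₀ with hμ
  set v : Fin n → k := X - μ • c with hv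
  have hv0 : v i₀ = 0 := by
    simp only [hv, hμ, Pi.sub_apply, Pi.smul_apply, smul_eq_mul]
    rw [div_mul_cancel₀ _ hc, sub_self]
  -- invariance along the whole line through `v`
  have hline : ∀ s : k, CobordantChart.initEval (fun _ : Fin n => 1) (v + s • c) o f =
      CobordantChart.initEval (fun _ : Fin n => 1) v o f := by
    intro s
    by_cases hs : s = 0
    · rw [hs, zero_smul, add_zero]
    · have h1 : v + s • c = s • (s⁻¹ • v + c) := by
        rw [smul_add, smul_smul, mul_inv_cancel₀ hs, one_smul]
      have h2 : v = s • (s⁻¹ • v) := by rw [smul_smul, mul_inv_cancel₀ hs, one_smul]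
      have hv' : (s⁻¹ • v) i₀ = 0 := by rw [Pi.smul_apply, hv0, smul_zero]
      rw [h1, AxisNormalize.initEval_smul, h (s⁻¹ • v) hv', ← AxisNormalize.initEval_smul, ← h2]
  have hX : X = v + μ • c := by rw [hv, sub_add_cancel]
  rw [hX, add_assoc, ← add_smul, hline, hline]

/-! ## §4 (N1) Near points of the point blow-up lie on the projectivised directrix -/

/-- **(N1) NEAR ⇒ ON `ℙ(Dir)`** (Cossart–Jannsen–Saito Thm 2.14 in hypersurface form, every characteristic, every dimension): under the
point move at the exceptional point `c` with live slot `i₀` and factorisation `f(s(c + y)) = s^o · G`, if the SLICED strict transform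
`G|_{y_{i₀} = 0}` still has order `≥ o` (the new point is NEAR), then `c` is a TRANSLATION-INVARIANCE VECTOR of the degree-`o` form of `f`:
`in_o f (v + t·c) = in_o f (v)` for all `v`, `t`.  [cite: CossartJannsenSaito2020, Thm 2.14 (LNM 2270; corpus p0038)] -/
theorem initEval_add_smul_eq_of_near {n : ℕ} (f : MvPowerSeries (Fin (n + 1)) k) (c : Fin (n + 1) → k) (i₀ : Fin (n + 1))
    (hc : c i₀ ≠ 0) {o : ℕ} {G : MvPowerSeries (Fin (n + 1 + 1)) k}
    (hfac : subst (CobordantChart.chart (fun _ : Fin (n + 1) => 1) c) f = X 0 ^ o * G)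
    (hnear : (o : ℕ∞) ≤ (TupleGame.slice i₀ G).order) (t : k) (v : Fin (n + 1) → k) :
    CobordantChart.initEval (fun _ : Fin (n + 1) => 1) (v + t • c) o f = CobordantChart.initEval (fun _ : Fin (n + 1) => 1) v o f := by
  refine initEval_add_smul_eq_of_slicePlane i₀ hc (initEval_add_eq_of_taylor f c i₀ fun β hβ0 hβlt => ?_) t v
  rw [taylorSum_eq_coeff_slice f c i₀ o β hβ0, hfac, NCTransport.slice_X_zero_pow_mul', CoeffTransport.coeff_cons_X_pow_mul]
  refine coeff_of_lt_order (lt_of_lt_of_le ?_ hnear)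
  rw [CoeffTransport.degree_cons_zero, degree_restrict i₀ β hβ0]
  exact_mod_cast hβlt

/-- **(E0) NO INVARIANCE VECTOR ⇒ THE ORDER DROPS AT EVERY POINT OF THE EXCEPTIONAL DIVISOR**: if the degree-`o` form of `f` has no non-zero
translation-invariance vector (`e_x = 0`), then at every exceptional point `c` and every live slot `i₀` the sliced strict transform has order `< o` —
the point move has no near answer. -/
theorem order_slice_lt_of_apexTrivial {n : ℕ} (f : MvPowerSeries (Fin (n + 1)) k) {o : ℕ}
    (hapex : ∀ u : Fin (n + 1) → k,
      (∀ v, CobordantChart.initEval (fun _ : Fin (n + 1) => 1) (v + u) o f = CobordantChart.initEval (fun _ : Fin (n + 1) => 1) v o f) →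
      u = 0)
    (c : Fin (n + 1) → k) (i₀ : Fin (n + 1)) (hc : c i₀ ≠ 0) {G : MvPowerSeries (Fin (n + 1 + 1)) k}
    (hfac : subst (CobordantChart.chart (fun _ : Fin (n + 1) => 1) c) f = X 0 ^ o * G) :
    (TupleGame.slice i₀ G).order < o := by
  by_contra hle
  rw [not_lt] at hle
  have h := hapex c fun v => by
    have h1 := initEval_add_smul_eq_of_near f c i₀ hc hfac hle 1 v
    rwa [one_smul] at h1
  exact hc (by rw [h]; rfl)

end TOT2Near

end Summit.ResolutionOfSingularities.ResolutionOfSingularities.Theorems
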